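import Summits.ABC.IUTFork.Thm311RealInd1StripPacketHullDyadic
import Literature.IUT.LogVolume.TensorPacketDeepDyadicSqrtNegOne
import Literature.IUT.LogVolume.PacketPolydiscVolumeGap
import HarnessLib

/-!
# [IUTchIII] Thm 3.11 (i) (Ind1)+(Ind2) on a GENUINE TENSOR PACKET all of whose factors are `≅ ℚ₂(√−1)`: the trace ceiling of ANY factorwise-strip
# `H ≤ indTwo` (`p`-generic) and, at `p = 2`, the hull of the `H`-orbit of EVERY principal region `y·(R_I)^∼ ⊆ c·log₂(R_I^×)` MISSES the Dupuy–Hilado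
# container hull by one shell, with the log-volume gap `(Σ_j f(L_j)/D)·log 2` (UNCONDITIONAL; no room condition, no Jannsen–Wingberg / Diekert–Nishio binder)

PROOF-ONLY file (abc-iut cell, Cor. 3.12 sub-crew, seat abc-iut-c312-1 = holder of record of the typed [IUTchIII] Thm. 3.11, gen 27; row
«C:P2-PRIME-DICHOTOMY ⟹ STRICTNESS», file 2/3, over gen 24's `Thm311RealInd1StripPacketHullDyadic` (R35: radii / ceiling part / displayed iff at an
all-`ℚ₂(√−1)` packet; it re-exports gen 15's `Thm311RealInd1StripPacketCeiling`), gen 21's `PacketPolydiscVolumeGap`, gen 11's trace rigidity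
`Thm311RealInd1StripTraceRigid` and the classical `Literature.IUT.LogVolume.TensorPacketDeepDyadicSqrtNegOne` (file 1/3: ALWAYS DEEP)).
TAKES NO SIDE on [IUTchIII] Cor. 3.12.  No definition, no `Prop` fact, no instance, no notation.

WHY.  The tame prime-level rows (R30 `Thm311RealInd1StripPrimeDichotomy`) say: at a prime `p > 2` over which every place of the section is tame of odd
local degree `≥ 3`, `ln ν̄_{𝕃_p}(reading (P) over H) = −|log(Θ)|^{(P)}_p` ⟺ every collection has room at its twisted slot, else `<`.  The C LEAD held the
`p = 2` twin as offer (ψ) «C:P2-PRIME-DICHOTOMY» (C-R202 (c)): by gen 24's packet iff, identity at an all-`ℚ₂(√−1)` collection ⟺ the Θ-region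
`ι_j(t)·(R_I)^∼` reaches the top polyshell of its content container in every component — and file 1/3 proves that it NEVER does (every collection has
`≥ 2` factors; the nontrivial idempotents of `(R_I)^∼` against the all-or-nothing top polyshell).  THIS FILE draws the packet-level consequences; file
3/3 (`Thm311RealInd1StripPrimeStrictnessDyadic`) carries them to `ln ν̄_{𝕃_2}` over a place section.

* §1 (one place `v ∣ p`, `p`-GENERIC, UNCONDITIONAL) **`trace_apply_eq_of_mem_closure_ind1StripOf`** — every element of the ADDITIVE closure of print's
  realised (Ind1) strip group `Real.ind1StripOf v (Real.galoisLog v)` (and its inverse) PRESERVES `Tr_{K_v/ℚ_p}` (R13 `trace_apply_eq_of_mem_ind1StripOf`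
  on generators; composition / inverses);
* §2 (genuine packet `X = ⊗_{ℚ_p} K_{w_b}`, `p`-GENERIC) **`trace_apply_eq_of_factorwise_strip`** — a `ℚ_p`-linear map acting on pure tensors factorwise
  through such elements preserves `Tr_{X/ℚ_p}` (`Tr_X(⊗z_b) = Π Tr(z_b)`, abc-iut-S6); hence **`iUnion_image_subset_add_inter_ker_of_factorwise_strip`**:
  for `H ≤ indTwo` acting factorwise through the realised strip groups (the class of R28–R32's prime-level rows, WITHOUT the «contains the strip moves»
  clause) and ANY region `M ⊆ c·log_p(R_I^×)`, the `H`-orbit lies in the ceiling `M + (c·log_p(R_I^×) ∩ Ker Tr_X)` (the packet twin, for this class, of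
  gen 15's `image_subset_add_inter_ker_of_factorwise_printInd1Ind2`);
* §3 (genuine all-`ℚ₂(√−1)` packet, two factors `b₀ ≠ b₁`) **`packetHull_orbitH_ne_container_of_dyadicSqrtNegOne`** — for EVERY `y` with
  `y·(R_I)^∼ ⊆ c·log₂(R_I^×)`, `c ≠ 0`: `packetHull(H-orbit of y·(R_I)^∼) ≠ packetHull(c·log₂(R_I^×))` (gen 24's iff + file 1's
  `not_forall_le_hullRadius_image_smul_normalizedPacket`), and the LOG-VOLUME GAP **`packetLogμ_packetHull_orbitH_le_container_sub_of_dyadicSqrtNegOne`**: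
  `log μ̄(packetHull(H-orbit of ι_{i₀}(g)·(R_I)^∼)) ≤ log μ̄(packetHull(2^m·log₂(R_I^×))) − (Σ_j f(L_j)/D)·log 2` whenever `ι_{i₀}(g)·(R_I)^∼ ⊆
  2^m·log₂(R_I^×)` (e.g. `m` = its content) — for EVERY `g ≠ 0`, no room condition (the orbit sits in the sub-polydisc `‖2^m‖·ρ^{3n+1}`; gen 21's
  `packetLogμ_packetHull_le_container_sub_of_subset_preimage_polydisc_of_lt`).
READING (numbers about OUR typed objects; neutral): at a genuine all-`ℚ₂(√−1)` packet, whatever principal region a Θ-pilot presents, the hull of its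
orbit under print's factorwise (Ind1) strip part inside the Dupuy–Hilado container is STRICTLY smaller than the container hull, with a log-volume gap of at
least `(Σ_j f_j/D)·log 2 ≥ (log 2)/D`.  HONEST SCOPE: OUR typings (THE equivariant lift, THE logarithm, factorwise action; F-B28-1 untouched); packets all of
whose factors have shape `(e, f) = (2, 1)` with `√−1`, at least two of them (mixed dyadic packets and dyadic local degree `≥ 4` NOT treated); nothing
here computes `ln ν̄_{𝕃_2}` (file 3/3); nothing about print's indeterminacies beyond the typed (Ind1)⊔(Ind2); equal-AS-TYPED ≠ equal in print;
nothing here asserts that abc is proved or refuted; no side taken on [IUTchIII] Cor. 3.12 / [IUTchIV] Thm. 1.10 or on any author.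
[claim: Mochizuki2012, status: disputed]; [cite: Mochizuki2012, IUTchIII Thm. 3.11 (i) (Ind1)(Ind2) p. 154; Rmk. 3.9.5 (i) p. 127; Cor. 3.12 proof
Step (x) p. 181, Step (xi) p. 183; IUTchIV Prop. 1.1 p. 9, Prop. 1.4 (i)(iii) p. 13]; [cite: HoshiNishio2022OuterAutMLF, Lemma 2.3 (ii) p. 7];
[cite: DupuyHilado2025, §3.7, §4.9, §4.12]; [cite: NeukirchANT1999, Ch. II Prop. (5.5), (5.7)]. typed ≠ proved; located ≠ adjudicated.
-/

set_option autoImplicit false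

noncomputable section

open Metric Set Function Module Bornology
open scoped Pointwise TensorProduct

namespace Summit.ABC.IUTFork.Thm311.Real

open NumberField IsDedekindDomain Literature.NumberTheory.NumberFields Literature.IUT.LogVolume
open Literature.NumberTheory.GaloisRepresentations Literature.NumberTheory.GaloisRepresentations.Ultrametric
open Literature.AnabelianGeometry.AbsoluteAnabelian Literature.IUT.HodgeArakelov
open Literature.IUT.HodgeArakelov.AbsTopMonoids Literature.IUT.LogThetaLattice
open Literature.IUT.LogVolume.TraceZeroDyadicSqrtNegOne

/-! ## §1 One place: the additive closure of print's realised strip group preserves the trace (`p`-generic) -/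

section OnePlace

variable {F : Type} [Field F] [NumberField F] (v : HeightOneSpectrum (𝓞 F))
variable (p : ℕ) [hp : Fact p.Prime] (hv : ((p : ℕ) : 𝓞 F) ∈ v.asIdeal)

/-- **Every element of the additive closure of print's realised (Ind1) strip group PRESERVES `Tr_{K_v/ℚ_p}`, and so does its inverse**
(UNCONDITIONAL; `p`-generic).  Generators: R13 `trace_apply_eq_of_mem_ind1StripOf` (Hoshi–Nishio Lemma 2.3 (ii)); the property is closed under
composition and inversion (Mathlib writes `AddAut K_v` additively). [claim: Mochizuki2012, status: disputed]
[cite: Mochizuki2012, IUTchIII Thm. 3.11 (i) (Ind1) p. 154] [cite: HoshiNishio2022OuterAutMLF, Lemma 2.3 (ii) p. 7] -/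
theorem trace_apply_eq_of_mem_closure_ind1StripOf {δ : AddAut (v.adicCompletion F)}
    (hδ : δ ∈ AddSubgroup.closure (G := AddAut (v.adicCompletion F)) (ind1StripOf v (galoisLog v))) (x : v.adicCompletion F) :
    Algebra.trace ℚ_[p] (RescaledCompletion F p v hv) (RescaledCompletion.of F p v hv (δ x)) =
        Algebra.trace ℚ_[p] (RescaledCompletion F p v hv) (RescaledCompletion.of F p v hv x) ∧
      Algebra.trace ℚ_[p] (RescaledCompletion F p v hv) (RescaledCompletion.of F p v hv (δ.symm x)) =
        Algebra.trace ℚ_[p] (RescaledCompletion F p v hv) (RescaledCompletion.of F p v hv x) := by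
  obtain rfl : p = (closureAt v).residueChar := eq_residueChar_closureAt_of_natCast_mem v hv
  revert x
  induction hδ using AddSubgroup.closure_induction with
  | mem ψ hψ =>
    intro x
    refine ⟨trace_apply_eq_of_mem_ind1StripOf v hψ x, ?_⟩
    have h := trace_apply_eq_of_mem_ind1StripOf v hψ (ψ.symm x)
    rw [AddEquiv.apply_symm_apply] at h
    exact h.symm
  | zero => intro x; exact ⟨rfl, rfl⟩
  | add γ₁ γ₂ _ _ ih₁ ih₂ =>
    intro x
    refine ⟨?_, ?_⟩
    · rw [AddAut.add_apply]; exact ((ih₁ (γ₂ x)).1).trans (ih₂ x).1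
    · have h : (γ₁ + γ₂).symm x = γ₂.symm (γ₁.symm x) := rfl
      rw [h]; exact ((ih₂ (γ₁.symm x)).2).trans (ih₁ x).2
  | neg γ _ ih =>
    intro x
    refine ⟨?_, ?_⟩
    · rw [AddAut.neg_apply]; exact (ih x).2
    · have h : (-γ).symm x = γ x := by rw [AddAut.neg_def, AddEquiv.symm_symm]
      rw [h]; exact (ih x).1

end OnePlace

/-! ## §2 Genuine packets: factorwise-strip elements preserve the packet trace; the `H`-orbit lies in the trace ceiling (`p`-generic) -/

section Packet

variable {K : Type} [Field K] [NumberField K] (p : ℕ) [hp : Fact p.Prime]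
variable {I : Type} [Fintype I] [DecidableEq I] (w : I → HeightOneSpectrum (𝓞 K)) (hw : ∀ i, ((p : ℕ) : 𝓞 K) ∈ (w i).asIdeal)

omit [DecidableEq I] in
/-- **A factorwise-strip linear map PRESERVES THE PACKET TRACE (UNCONDITIONAL; `p`-generic).**  On `X = ⊗_{ℚ_p, i} K_{w_i}` (genuine completions,
rescaled), a `ℚ_p`-linear `g` acting on pure tensors factorwise through elements `δ_i` of the additive closures of print's realised (Ind1) strip
groups satisfies `Tr_{X/ℚ_p}(g y) = Tr_{X/ℚ_p}(y)` for all `y` (`Tr_X(⊗ z_i) = Π_i Tr(z_i)` and §1). [claim: Mochizuki2012, status: disputed]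
[cite: Mochizuki2012, IUTchIII Thm. 3.11 (i) (Ind1) p. 154] [cite: HoshiNishio2022OuterAutMLF, Lemma 2.3 (ii) p. 7] -/
theorem trace_apply_eq_of_factorwise_strip
    (δ : Π i, AddAut ((w i).adicCompletion K))
    (hδ : ∀ i, δ i ∈ AddSubgroup.closure (G := AddAut ((w i).adicCompletion K)) (ind1StripOf (w i) (galoisLog (w i))))
    (g : PacketAlgebra p (fun i => RescaledCompletion K p (w i) (hw i)) →ₗ[ℚ_[p]]
      PacketAlgebra p (fun i => RescaledCompletion K p (w i) (hw i)))
    (hg : ∀ z : Π i, RescaledCompletion K p (w i) (hw i),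
      g (PiTensorProduct.tprod ℚ_[p] z) =
        PiTensorProduct.tprod ℚ_[p] (fun i =>
          RescaledCompletion.of K p (w i) (hw i) (δ i ((RescaledCompletion.of K p (w i) (hw i)).symm (z i)))))
    (y : PacketAlgebra p (fun i => RescaledCompletion K p (w i) (hw i))) :
    Algebra.trace ℚ_[p] (PacketAlgebra p (fun i => RescaledCompletion K p (w i) (hw i))) (g y) =
      Algebra.trace ℚ_[p] (PacketAlgebra p (fun i => RescaledCompletion K p (w i) (hw i))) y := by
  induction y using PiTensorProduct.induction_on with
  | smul_tprod r x =>
    rw [map_smul, map_smul, hg, map_smul]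
    congr 1
    have h1 := trace_purePacket p (fun i => RescaledCompletion K p (w i) (hw i))
      (fun i => RescaledCompletion.of K p (w i) (hw i) (δ i ((RescaledCompletion.of K p (w i) (hw i)).symm (x i))))
    have h2 := trace_purePacket p (fun i => RescaledCompletion K p (w i) (hw i)) x
    simp only [purePacket] at h1 h2
    rw [h1, h2]
    refine Finset.prod_congr rfl fun i _ => ?_
    have h := (trace_apply_eq_of_mem_closure_ind1StripOf (w i) p (hw i) (hδ i) ((RescaledCompletion.of K p (w i) (hw i)).symm (x i))).1
    rwa [RingEquiv.apply_symm_apply] at h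
  | add a b ha hb => rw [map_add, map_add, ha, hb, map_add]

omit [DecidableEq I] in
/-- **THE TRACE CEILING OF A FACTORWISE-STRIP `H ≤ indTwo` (UNCONDITIONAL; `p`-generic).**  For a subgroup `H` of the packet automorphisms
contained in Dupuy–Hilado's container `indTwo` and acting on pure tensors factorwise through the additive closures of the realised strip groups (the
class of the lineage's prime-level rows R28–R32, here WITHOUT the «contains the strip moves» clause), every `c ∈ ℚ_p` and EVERY region
`M ⊆ c·log_p(R_I^×)`: the `H`-orbit `⋃_{γ ∈ H} γ(M)` lies in the ceiling `M + (c·log_p(R_I^×) ∩ Ker Tr_X)` — `γ x = x + (γ x − x)` with `γ x ∈ c·log_p(R_I^×)`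
(`γ ∈ indTwo`) and `Tr_X(γ x − x) = 0`. [claim: Mochizuki2012, status: disputed] [cite: Mochizuki2012, IUTchIII Thm. 3.11 (i) p. 154]
[cite: DupuyHilado2025, §4.9] [cite: HoshiNishio2022OuterAutMLF, Lemma 2.3 (ii) p. 7] -/
theorem iUnion_image_subset_add_inter_ker_of_factorwise_strip
    (H : Subgroup (PacketAlgebra p (fun i => RescaledCompletion K p (w i) (hw i)) ≃ₗ[ℚ_[p]]
      PacketAlgebra p (fun i => RescaledCompletion K p (w i) (hw i))))
    (hH : H ≤ indTwo p (fun i => RescaledCompletion K p (w i) (hw i)))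
    (hHfac : ∀ γ ∈ H, ∃ δ : Π i, AddAut ((w i).adicCompletion K),
      (∀ i, δ i ∈ AddSubgroup.closure (G := AddAut ((w i).adicCompletion K)) (ind1StripOf (w i) (galoisLog (w i)))) ∧
      ∀ z : Π i, RescaledCompletion K p (w i) (hw i),
        γ (PiTensorProduct.tprod ℚ_[p] z) =
          PiTensorProduct.tprod ℚ_[p] (fun i => RescaledCompletion.of K p (w i) (hw i)
            (δ i ((RescaledCompletion.of K p (w i) (hw i)).symm (z i)))))
    (c : ℚ_[p]) {M : Set (PacketAlgebra p (fun i => RescaledCompletion K p (w i) (hw i)))}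
    (hM : M ⊆ c • (logPacket p (fun i => RescaledCompletion K p (w i) (hw i)) :
      Set (PacketAlgebra p (fun i => RescaledCompletion K p (w i) (hw i))))) :
    (⋃ γ : H, (γ : PacketAlgebra p (fun i => RescaledCompletion K p (w i) (hw i)) ≃ₗ[ℚ_[p]]
        PacketAlgebra p (fun i => RescaledCompletion K p (w i) (hw i))) '' M) ⊆
      M + (c • (logPacket p (fun i => RescaledCompletion K p (w i) (hw i)) :
          Set (PacketAlgebra p (fun i => RescaledCompletion K p (w i) (hw i)))) ∩
        {y | Algebra.trace ℚ_[p] (PacketAlgebra p (fun i => RescaledCompletion K p (w i) (hw i))) y = 0}) := by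
  set L : Set (PacketAlgebra p (fun i => RescaledCompletion K p (w i) (hw i))) :=
    (logPacket p (fun i => RescaledCompletion K p (w i) (hw i)) :
      Set (PacketAlgebra p (fun i => RescaledCompletion K p (w i) (hw i)))) with hL
  have hcL_sub : ∀ a b, a ∈ c • L → b ∈ c • L → a - b ∈ c • L := by
    intro a b ha hb
    obtain ⟨a', ha', rfl⟩ := Set.mem_smul_set.mp ha
    obtain ⟨b', hb', rfl⟩ := Set.mem_smul_set.mp hb
    rw [← smul_sub]
    exact Set.smul_mem_smul_set ((logPacket p _).sub_mem ha' hb')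
  refine Set.iUnion_subset fun γ => ?_
  rintro _ ⟨x, hx, rfl⟩
  obtain ⟨δ, hδ, hγ⟩ := hHfac γ γ.2
  have hγ2 : (γ : PacketAlgebra p (fun i => RescaledCompletion K p (w i) (hw i)) ≃ₗ[ℚ_[p]] _) ∈ indTwo p _ := hH γ.2
  have hxL : x ∈ c • L := hM hx
  have hγx : (γ : PacketAlgebra p (fun i => RescaledCompletion K p (w i) (hw i)) ≃ₗ[ℚ_[p]] _) x ∈ c • L := by
    obtain ⟨x', hx', rfl⟩ := Set.mem_smul_set.mp hxL
    rw [map_smul]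
    exact Set.smul_mem_smul_set ((((mem_indTwo_iff p _ _).1 hγ2) x').2 hx')
  refine ⟨x, hx, (γ : PacketAlgebra p (fun i => RescaledCompletion K p (w i) (hw i)) ≃ₗ[ℚ_[p]] _) x - x,
    ⟨hcL_sub _ _ hγx hxL, ?_⟩, add_sub_cancel x _⟩
  change Algebra.trace ℚ_[p] _ ((γ : PacketAlgebra p (fun i => RescaledCompletion K p (w i) (hw i)) ≃ₗ[ℚ_[p]] _) x - x) = 0
  rw [map_sub, sub_eq_zero]
  exact trace_apply_eq_of_factorwise_strip p w hw δ hδ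
    ((γ : PacketAlgebra p (fun i => RescaledCompletion K p (w i) (hw i)) ≃ₗ[ℚ_[p]] _).toLinearMap) (fun z => hγ z) x

omit [Fintype I] [DecidableEq I] in
/-- A region lies in its `H`-orbit (the identity is in `H`). [cite: DupuyHilado2025, §4.9] [claim: Mochizuki2012, status: disputed] -/
theorem subset_iUnion_image_orbitH
    (H : Subgroup (PacketAlgebra p (fun i => RescaledCompletion K p (w i) (hw i)) ≃ₗ[ℚ_[p]]
      PacketAlgebra p (fun i => RescaledCompletion K p (w i) (hw i))))
    (M : Set (PacketAlgebra p (fun i => RescaledCompletion K p (w i) (hw i)))) :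
    M ⊆ ⋃ γ : H, (γ : PacketAlgebra p (fun i => RescaledCompletion K p (w i) (hw i)) ≃ₗ[ℚ_[p]]
        PacketAlgebra p (fun i => RescaledCompletion K p (w i) (hw i))) '' M := by
  intro x hx
  refine Set.mem_iUnion.mpr ⟨(1 : H), ?_⟩
  have h1 : (((1 : H) : PacketAlgebra p (fun i => RescaledCompletion K p (w i) (hw i)) ≃ₗ[ℚ_[p]]
      PacketAlgebra p (fun i => RescaledCompletion K p (w i) (hw i))) : _ → _) = id := by
    rw [OneMemClass.coe_one, LinearEquiv.coe_one]
  rw [h1]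
  exact ⟨x, hx, rfl⟩

end Packet

/-! ## §3 Genuine all-`ℚ₂(√−1)` packets: the `H`-orbit hull misses the container; the log-volume gap (UNCONDITIONAL, no room condition) -/

section Dyadic

variable {K : Type} [Field K] [NumberField K]
variable {I : Type} [Fintype I] [DecidableEq I] (w : I → HeightOneSpectrum (𝓞 K)) (hw : ∀ b, ((2 : ℕ) : 𝓞 K) ∈ (w b).asIdeal)
variable {ι : Π b, RescaledCompletion K 2 (w b) (hw b)} (hι : ∀ b, ι b ^ 2 = -1)
  (he : ∀ b, absRamificationIdx 2 (RescaledCompletion K 2 (w b) (hw b)) = 2)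
  (hf : ∀ b, residueDegree 2 (RescaledCompletion K 2 (w b) (hw b)) = 1)
  {ϖ : Π b, (RescaledCompletion K 2 (w b) (hw b))ˣ} (hϖ : ∀ b, IsUniformizer (ϖ b))

include hι he hf hϖ

/-- **THE `H`-ORBIT HULL OF A PRINCIPAL REGION IS NEVER THE CONTAINER's** (genuine all-`ℚ₂(√−1)` packet with two factors `b₀ ≠ b₁`; UNCONDITIONAL).
For `H ≤ indTwo` acting factorwise through the realised strip groups, `c ≠ 0` and ANY `y` with `y·(R_I)^∼ ⊆ c·log₂(R_I^×)`:
`packetHull(⋃_{γ∈H} γ(y·(R_I)^∼)) ≠ packetHull(c·log₂(R_I^×))` — the orbit lies in the trace ceiling (§2), so by gen 24's displayed iff equality would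
force `y·(R_I)^∼` to reach the top polyshell, which file 1/2 (`not_forall_le_hullRadius_image_smul_normalizedPacket`) forbids.
[claim: Mochizuki2012, status: disputed] [cite: Mochizuki2012, IUTchIII Thm. 3.11 (i) p. 154; Rmk. 3.9.5 (i) p. 127; Cor. 3.12 Step (xi) p. 183]
[cite: DupuyHilado2025, §4.9, §4.12] [cite: NeukirchANT1999, Ch. II Prop. (5.5), (5.7)] -/
theorem packetHull_orbitH_ne_container_of_dyadicSqrtNegOne {b₀ b₁ : I} (hb : b₀ ≠ b₁)
    (H : Subgroup (PacketAlgebra 2 (fun b => RescaledCompletion K 2 (w b) (hw b)) ≃ₗ[ℚ_[2]]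
      PacketAlgebra 2 (fun b => RescaledCompletion K 2 (w b) (hw b))))
    (hH : H ≤ indTwo 2 (fun b => RescaledCompletion K 2 (w b) (hw b)))
    (hHfac : ∀ γ ∈ H, ∃ δ : Π b, AddAut ((w b).adicCompletion K),
      (∀ b, δ b ∈ AddSubgroup.closure (G := AddAut ((w b).adicCompletion K)) (ind1StripOf (w b) (galoisLog (w b)))) ∧
      ∀ z : Π b, RescaledCompletion K 2 (w b) (hw b),
        γ (PiTensorProduct.tprod ℚ_[2] z) =
          PiTensorProduct.tprod ℚ_[2] (fun b => RescaledCompletion.of K 2 (w b) (hw b)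
            (δ b ((RescaledCompletion.of K 2 (w b) (hw b)).symm (z b)))))
    {c : ℚ_[2]} (hc : c ≠ 0) {y : PacketAlgebra 2 (fun b => RescaledCompletion K 2 (w b) (hw b))}
    (hy : y • (normalizedPacket 2 (fun b => RescaledCompletion K 2 (w b) (hw b)) :
        Set (PacketAlgebra 2 (fun b => RescaledCompletion K 2 (w b) (hw b)))) ⊆
      c • (logPacket 2 (fun b => RescaledCompletion K 2 (w b) (hw b)) :
        Set (PacketAlgebra 2 (fun b => RescaledCompletion K 2 (w b) (hw b))))) :
    packetHull 2 (fun b => RescaledCompletion K 2 (w b) (hw b))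
        (⋃ γ : H, (γ : PacketAlgebra 2 (fun b => RescaledCompletion K 2 (w b) (hw b)) ≃ₗ[ℚ_[2]]
            PacketAlgebra 2 (fun b => RescaledCompletion K 2 (w b) (hw b))) ''
          (y • (normalizedPacket 2 (fun b => RescaledCompletion K 2 (w b) (hw b)) :
        Set (PacketAlgebra 2 (fun b => RescaledCompletion K 2 (w b) (hw b)))))) ≠
      packetHull 2 (fun b => RescaledCompletion K 2 (w b) (hw b))
        (c • (logPacket 2 (fun b => RescaledCompletion K 2 (w b) (hw b)) :
        Set (PacketAlgebra 2 (fun b => RescaledCompletion K 2 (w b) (hw b))))) := by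
  set k := fun b => RescaledCompletion K 2 (w b) (hw b) with hk
  intro hEq
  have hS := iUnion_image_subset_add_inter_ker_of_factorwise_strip 2 w hw H hH hHfac c hy
  have hMS := subset_iUnion_image_orbitH 2 w hw H (y • (normalizedPacket 2 k : Set (PacketAlgebra 2 k)))
  have htop := (PacketHull.packetHull_eq_packetHull_smul_logPacket_iff k (DFac 2 k) (dEquiv 2 k) hι he hf hϖ b₀ hc hy hMS hS).mp hEq
  exact not_forall_le_hullRadius_image_smul_normalizedPacket k (DFac 2 k) (dEquiv 2 k) hι he hf hϖ hb hc hy htop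

/-- **THE LOG-VOLUME GAP (UNCONDITIONAL, NO ROOM CONDITION).**  Genuine all-`ℚ₂(√−1)` packet with two factors `b₀ ≠ b₁`; `H ≤ indTwo` acting
factorwise through the realised strip groups; `g ∈ K_{w_{i₀}}^×` and ANY `m` with `ι_{i₀}(g)·(R_I)^∼ ⊆ 2^m·log₂(R_I^×)` (e.g. the content of the
Θ-region).  Then the `(R_I)^∼`-hull of the `H`-orbit of `ι_{i₀}(g)·(R_I)^∼` is admissible and
`log μ̄(packetHull(⋃_{γ∈H} γ(ι_{i₀}(g)·(R_I)^∼))) ≤ log μ̄(packetHull(2^m·log₂(R_I^×))) − (Σ_j f(L_j)/D)·log 2`: the region is ALWAYS DEEP (file 1/2), the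
ceiling part is one shell down (gen 24 `norm_psi_le_of_mem_smul_logPacket_inter_ker`), so the orbit sits in the sub-polydisc `‖2^m‖·ρ^{3n+1}` below the
container's top `‖2^m‖·Π_b ‖ϖ_b³‖` (gen 21 `packetLogμ_packetHull_le_container_sub_of_subset_preimage_polydisc_of_lt`). [claim: Mochizuki2012, status: disputed]
[cite: Mochizuki2012, IUTchIII Thm. 3.11 (i) p. 154; Cor. 3.12 Step (x) p. 181, Step (xi) p. 183; IUTchIV Prop. 1.4 (iii) p. 13]
[cite: DupuyHilado2025, §3.7, §4.9, §4.12] [cite: NeukirchANT1999, Ch. II Prop. (5.5), (5.7)] -/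
theorem packetLogμ_packetHull_orbitH_le_container_sub_of_dyadicSqrtNegOne {b₀ b₁ : I} (hb : b₀ ≠ b₁)
    (i₀ : I) {g : RescaledCompletion K 2 (w i₀) (hw i₀)} (hg0 : g ≠ 0) {m : ℤ}
    (hm : iota 2 (fun b => RescaledCompletion K 2 (w b) (hw b)) i₀ g •
        (normalizedPacket 2 (fun b => RescaledCompletion K 2 (w b) (hw b)) :
        Set (PacketAlgebra 2 (fun b => RescaledCompletion K 2 (w b) (hw b)))) ⊆
      (((2 : ℕ) : ℚ_[2]) ^ m) • (logPacket 2 (fun b => RescaledCompletion K 2 (w b) (hw b)) :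
        Set (PacketAlgebra 2 (fun b => RescaledCompletion K 2 (w b) (hw b)))))
    (H : Subgroup (PacketAlgebra 2 (fun b => RescaledCompletion K 2 (w b) (hw b)) ≃ₗ[ℚ_[2]]
      PacketAlgebra 2 (fun b => RescaledCompletion K 2 (w b) (hw b))))
    (hH : H ≤ indTwo 2 (fun b => RescaledCompletion K 2 (w b) (hw b)))
    (hHfac : ∀ γ ∈ H, ∃ δ : Π b, AddAut ((w b).adicCompletion K),
      (∀ b, δ b ∈ AddSubgroup.closure (G := AddAut ((w b).adicCompletion K)) (ind1StripOf (w b) (galoisLog (w b)))) ∧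
      ∀ z : Π b, RescaledCompletion K 2 (w b) (hw b),
        γ (PiTensorProduct.tprod ℚ_[2] z) =
          PiTensorProduct.tprod ℚ_[2] (fun b => RescaledCompletion.of K 2 (w b) (hw b)
            (δ b ((RescaledCompletion.of K 2 (w b) (hw b)).symm (z b))))) :
    PacketAdm 2 (fun b => RescaledCompletion K 2 (w b) (hw b))
        (packetHull 2 (fun b => RescaledCompletion K 2 (w b) (hw b))
          (⋃ γ : H, (γ : PacketAlgebra 2 (fun b => RescaledCompletion K 2 (w b) (hw b)) ≃ₗ[ℚ_[2]]
              PacketAlgebra 2 (fun b => RescaledCompletion K 2 (w b) (hw b))) ''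
            (iota 2 (fun b => RescaledCompletion K 2 (w b) (hw b)) i₀ g •
              (normalizedPacket 2 (fun b => RescaledCompletion K 2 (w b) (hw b)) :
        Set (PacketAlgebra 2 (fun b => RescaledCompletion K 2 (w b) (hw b))))))) ∧
      packetLogμ 2 (fun b => RescaledCompletion K 2 (w b) (hw b))
          (packetHull 2 (fun b => RescaledCompletion K 2 (w b) (hw b))
            (⋃ γ : H, (γ : PacketAlgebra 2 (fun b => RescaledCompletion K 2 (w b) (hw b)) ≃ₗ[ℚ_[2]]
                PacketAlgebra 2 (fun b => RescaledCompletion K 2 (w b) (hw b))) ''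
              (iota 2 (fun b => RescaledCompletion K 2 (w b) (hw b)) i₀ g •
                (normalizedPacket 2 (fun b => RescaledCompletion K 2 (w b) (hw b)) :
        Set (PacketAlgebra 2 (fun b => RescaledCompletion K 2 (w b) (hw b))))))) ≤
        packetLogμ 2 (fun b => RescaledCompletion K 2 (w b) (hw b))
            (packetHull 2 (fun b => RescaledCompletion K 2 (w b) (hw b))
              ((((2 : ℕ) : ℚ_[2]) ^ m) • (logPacket 2 (fun b => RescaledCompletion K 2 (w b) (hw b)) :
        Set (PacketAlgebra 2 (fun b => RescaledCompletion K 2 (w b) (hw b)))))) -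
          (∑ j, (residueDegree 2 (DFac 2 (fun b => RescaledCompletion K 2 (w b) (hw b)) j) : ℝ)) /
              packetDegree 2 (DFac 2 (fun b => RescaledCompletion K 2 (w b) (hw b))) * Real.log 2 := by
  set k := fun b => RescaledCompletion K 2 (w b) (hw b) with hk
  haveI : Nonempty I := ⟨i₀⟩
  set c : ℚ_[2] := ((2 : ℕ) : ℚ_[2]) ^ m with hc
  set M : Set (PacketAlgebra 2 k) := iota 2 k i₀ g • (normalizedPacket 2 k : Set (PacketAlgebra 2 k)) with hM
  set U : Set (PacketAlgebra 2 k) := ⋃ γ : H, (γ : PacketAlgebra 2 k ≃ₗ[ℚ_[2]] PacketAlgebra 2 k) '' M with hU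
  set R' : ℝ := ‖c‖ * ‖(ϖ b₀ : k b₀)‖ ^ (3 * Fintype.card I + 1) with hR'
  -- the orbit is confined to the sub-polydisc `R'`
  have hUS := iUnion_image_subset_add_inter_ker_of_factorwise_strip 2 w hw H hH hHfac c hm
  have hUR : U ⊆ dEquiv 2 k ⁻¹' polydisc (DFac 2 k) (fun _ => R') := by
    intro u hu
    obtain ⟨x, hx, a, ha, rfl⟩ := hUS hu
    refine (mem_polydisc (DFac 2 k)).mpr fun j => ?_
    change ‖dEquiv 2 k (x + a) j‖ ≤ R'
    rw [map_add, Pi.add_apply]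
    exact (IsUltrametricDist.norm_add_le_max _ _).trans (max_le
      (norm_dEquiv_le_of_mem_smul_normalizedPacket_of_subset k hι he hf hϖ hb c hm hx j)
      (PacketHull.norm_psi_le_of_mem_smul_logPacket_inter_ker k (DFac 2 k) (dEquiv 2 k) hι he hf hϖ b₀ c ha j))
  -- the container's top: `‖c‖·Π_b ‖ϖ_b³‖ = ‖c‖·ρ^{3n} > R'`
  have hcΛ : ∀ b, ((ϖ b : k b)) ^ 3 ∈ logUnits (k b) := fun b => by
    rw [DyadicNoFixedBall.logUnits_eq_closedBall_cube_of_sq_eq_neg_one (hϖ b) (hι b) (he b) (hf b), mem_closedBall_zero_iff, norm_pow]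
  have hdom : ∀ b, ∀ z ∈ logUnits (k b), ‖z‖ ≤ ‖((ϖ b : k b)) ^ 3‖ := fun b z hz => by
    have h := (isGreatest_norm_logUnits (hϖ b) (hι b) (he b) (hf b)).2 ⟨z, hz, rfl⟩
    rw [norm_pow, ← zpow_natCast, Nat.cast_ofNat]; exact h
  have hprod : ∏ b, ‖((ϖ b : k b)) ^ 3‖ = ‖(ϖ b₀ : k b₀)‖ ^ (3 * Fintype.card I) := by
    rw [Finset.prod_congr rfl fun b _ => by rw [norm_pow, norm_uniformizer_eq k he hϖ b b₀], Finset.prod_const, Finset.card_univ,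
      ← pow_mul, mul_comm]
  have hR'lt : R' < ‖(((2 : ℕ) : ℚ_[2]) ^ m)‖ * ∏ b, ‖((ϖ b : k b)) ^ 3‖ := by
    rw [hprod, hR', hc]
    exact PacketHull.norm_mul_pow_succ_lt k hϖ b₀ (zpow_ne_zero m (by norm_num))
  have hA : PacketAdm 2 k M := packetAdm_iota_smul 2 k i₀ hg0 (packetAdm_normalizedPacket 2 k)
  have hAU : M ⊆ U := subset_iUnion_image_orbitH 2 w hw H M
  exact packetLogμ_packetHull_le_container_sub_of_subset_preimage_polydisc_of_lt 2 k m hcΛ hdom hR'lt hA hAU hUR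

end Dyadic

end Summit.ABC.IUTFork.Thm311.Real

end
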